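import Summits.NavierStokesRegularity.FluidComputer.ClayBlowupLerayHopfCompletion
import Summits.NavierStokesRegularity.FluidComputer.ClayBlowupRegularSetBound
import Literature.Analysis.FluidPDE.SwirlMaximumPrincipleForced
import Literature.Analysis.FluidPDE.KNSSPoloidalAxisDecay
import HarnessLib

/-!
# THE AZIMUTHAL CIRCULATION OF AN AXISYMMETRIC CLAY BLOW-UP IS BOUNDED UP TO THE BLOW-UP TIME
# (Kelvin's ceiling for the swirl is a theorem, WITH the Clay force); for the unforced type the
# blow-up is carried by the POLOIDAL field

Cell `ns-blowup`, seat `ns-blowup-ecbridge-2` (g8; the E–C endpoint theory seat). LABEL: E–C typing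
(KERNEL — no named fact). WHAT THIS IS NOT: not Navier–Stokes evidence — necessary conditions on the
TYPES `ClayBlowup ν` / `DesignedBlowup ν` (Leray's époque d'irrégularité for a Clay datum WITH a Clay
force; no inhabitant is claimed anywhere) when datum and force are axisymmetric. Companion memo:
`run/shared/lean/pub/ns-blowup/ecbridge2/ECBRIDGE-2-MEMO-7.md`.

## Content (row K10-F of MEMO-1: the swirl maximum principle with force, on the type)

For a Clay blow-up `X : ClayBlowup ν` (`ν > 0`) with axisymmetric datum `u(0)` and axisymmetric
force `f(t)`, `0 ≤ t < T`, the slices `u(t)` are axisymmetric (`ClayBlowup.isAxisymmetric`, lean g8's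
heredity theorem), the velocity is bounded on every closed sub-slab (`ClayBlowup.exists_norm_le`), the
datum has bounded swirl `|Γ₀| = |r u₀^θ| ≤ M` (Clay decay (4), `HasRapidSpatialDecay.abs_swirl_le`)
and the force has bounded azimuthal torque `|r f_θ(t, x)| ≤ F` for all `t ≥ 0` (Clay decay (5),
`ClayBlowup.exists_abs_swirl_force_le`). The FORCED swirl maximum principle
(`abs_swirl_le_of_classical_forced_Ico`, `Literature/…/SwirlMaximumPrincipleForced.lean`) then gives

* **`ClayBlowup.abs_swirl_le`** — `|Γ(t, x)| = |r u_θ(t, x)| ≤ M + F t` on `[0, T) × ℝ³`;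
* **`ClayBlowup.swirl_bounded`** — `sup_{[0,T) × ℝ³} |r u_θ| < ∞`: the azimuthal circulation of an
  axisymmetric Clay blow-up stays bounded THROUGH the blow-up (no unbounded amplification of the swirl
  by the design's own flow, whatever the Clay force does; the bound is the datum's swirl plus `T` times
  the force's torque);
* `ClayBlowup.abs_swirlVelocity_le` — `|u_θ(t, x)| ≤ C / r` off the axis (the azimuthal velocity obeys
  the Koch–Nadirashvili–Seregin–Šverák `C/r` bound automatically);
* `ClayBlowup.cylRadius_mul_norm_le_poloidal_add` — `r |u| ≤ r |ū| + C` (`ū` the poloidal part): every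
  `C/r`-type bound on the full velocity is a statement about the poloidal field alone;
* for the UNFORCED type (the ¬(A) witnesses): **`ClayBlowup.poloidal_axisDecay_unbounded`** —
  `sup_{[0,T) × ℝ³} r |ū| = ∞` (the second Koch–Nadirashvili–Seregin–Šverák alternative of
  `not_typeI_of_isAxisymmetric`, g7, transferred to the poloidal part: Seregin–Šverák 2009 state their
  hypothesis (1.2) on `v̄` precisely for this reason), and `axisymmetric_swirl_portrait_of_force_eq_zero`;
* the `DesignedBlowup` twins and the (C)-reading `axisymmetric_clayBlowup_swirl_bounded`.

Design reading (RATE-TABLE v0, D0): in a Palasek-type tower the per-structure circulation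
`Γ_k = N_k^{β−2}` increases without bound when `β > 2`; in an AXISYMMETRIC design realised as a Clay
blow-up that growth can never be carried by the swirl `r u_θ`, which is bounded by
`‖r u₀^θ‖_∞ + T · sup |r f_θ|` — it must sit in the poloidal field (vortex-ring circulation), for
which no maximum principle holds once swirl is present.

References: G. Koch, N. Nadirashvili, G. Seregin, V. Šverák, Acta Math. 203 (2009), (1.8)–(1.9) and
Thm. 6.1 [cite: KochNadirashviliSereginSverak2009, §1 (1.8)–(1.9)]; G. Seregin, V. Šverák, Comm. PDE 34
(2009) = arXiv:0804.1803, §1 (1.2), Thm. 1.2 [cite: SereginSverak2009, §1 (1.2)]; D. Chae, J. Lee,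
Math. Z. 239 (2002) §1 [cite: ChaeLee2002, §1]; C. L. Fefferman, Clay problem description, (A), (C),
(4), (5) [cite: FeffermanClay2006, (C)].
-/

noncomputable section

namespace Summit.NavierStokesRegularity.FluidComputer

open Set MeasureTheory Filter Topology Function
open scoped ENNReal ContDiff NNReal
open Literature.Analysis.FluidPDE
open Summit.NavierStokesRegularity.NavierStokesRegularity

namespace ClayBlowup

variable {ν : ℝ} (X : ClayBlowup ν)

/-! ## §1 The two constants: swirl of the datum, torque of the force -/

/-- **The datum of a Clay blow-up has bounded swirl**: `|r u₀^θ(x)| ≤ M` for some `M ≥ 0` (Clay decay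
(4) with `n = 0`, `K = 1`: `|Γ₀(x)| ≤ 2|x| |u₀(x)|`). [cite: FeffermanClay2006, (4)] -/
theorem exists_abs_swirl_datum_le : ∃ M : ℝ, 0 ≤ M ∧ ∀ x, |swirl (X.u 0) x| ≤ M := by
  obtain ⟨M, hM⟩ := X.datum_decay.abs_swirl_le
  exact ⟨max M 0, le_max_right _ _, fun x => (hM x).trans (le_max_left _ _)⟩

/-- **The force of a Clay blow-up has bounded azimuthal torque**: `|r f_θ(t, x)| = |swirl (f t) x| ≤ F`
for all `t ≥ 0` and all `x`, some `F ≥ 0` (Clay decay (5) with `n = 0`, `K = 1`: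
`(1 + |x| + t) |f(t, x)| ≤ C`, and `|swirl (f t) x| ≤ 2|x| |f(t, x)| ≤ 2C`). [cite: FeffermanClay2006, (5)] -/
theorem exists_abs_swirl_force_le :
    ∃ F : ℝ, 0 ≤ F ∧ ∀ t : ℝ, 0 ≤ t → ∀ x, |swirl (X.f t) x| ≤ F := by
  obtain ⟨C, hC⟩ := X.force_decay 0 1
  have hC0 : 0 ≤ C := by
    have h := hC 0 le_rfl 0
    rw [pow_one] at h
    exact le_trans (mul_nonneg (by positivity) (norm_nonneg _)) h
  refine ⟨2 * C, by positivity, fun t ht x => ?_⟩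
  have h := hC t ht x
  rw [pow_one, norm_iteratedFDerivWithin_zero] at h
  have hfx : ‖x‖ * ‖X.f t x‖ ≤ C := by
    have h1 : ‖x‖ * ‖X.f t x‖ ≤ (1 + ‖x‖ + t) * ‖uncurry X.f (t, x)‖ := by
      simp only [uncurry_apply_pair]
      gcongr
      linarith [norm_nonneg x]
    exact h1.trans h
  calc |swirl (X.f t) x| ≤ 2 * ‖x‖ * ‖X.f t x‖ := abs_swirl_le_norm_mul (X.f t) x
    _ = 2 * (‖x‖ * ‖X.f t x‖) := by ring
    _ ≤ 2 * C := by gcongr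

/-! ## §2 The swirl maximum principle with force, on the type -/

/-- **THE SWIRL OF AN AXISYMMETRIC CLAY BLOW-UP GROWS AT MOST LINEARLY** (`ν > 0`; no named fact):
if the datum `u(0)` is axisymmetric and the force `f(t)` is axisymmetric for `0 ≤ t < T`, and
`|r u₀^θ| ≤ M`, `|r f_θ(t, ·)| ≤ F` on `[0, T)`, then `|r u_θ(t, x)| ≤ M + F t` for all
`t ∈ [0, T)` and all `x`. The slices stay axisymmetric (`ClayBlowup.isAxisymmetric`), the velocity is
bounded on every closed sub-slab (`ClayBlowup.exists_norm_le`), and the forced swirl maximum principle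
`abs_swirl_le_of_classical_forced_Ico` applies. [cite: KochNadirashviliSereginSverak2009, §1 (1.8)–(1.9)] -/
theorem abs_swirl_le (hν : 0 < ν) (h0A : IsAxisymmetric (X.u 0))
    (hfA : ∀ t ∈ Ico 0 X.T, IsAxisymmetric (X.f t)) {M F : ℝ}
    (hM : ∀ x, |swirl (X.u 0) x| ≤ M) (hF : ∀ t ∈ Ico 0 X.T, ∀ x, |swirl (X.f t) x| ≤ F) :
    ∀ t ∈ Ico 0 X.T, ∀ x, |swirl (X.u t) x| ≤ M + F * t :=
  abs_swirl_le_of_classical_forced_Ico hν.le X.classical (X.isAxisymmetric hν h0A hfA) hfA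
    (fun _ hT' => X.exists_norm_le hν hT') hM hF

/-- **THE AZIMUTHAL CIRCULATION OF AN AXISYMMETRIC CLAY BLOW-UP IS BOUNDED UP TO THE BLOW-UP TIME**
(`ν > 0`; no named fact): with axisymmetric datum and force, `sup_{t < T, x} |r u_θ(t, x)| < ∞` —
explicitly `≤ M + F T` with `M` the swirl bound of the datum and `F` the torque bound of the Clay
force (`exists_abs_swirl_datum_le`, `exists_abs_swirl_force_le`).
[cite: KochNadirashviliSereginSverak2009, §1 (1.8)–(1.9)] -/
theorem swirl_bounded (hν : 0 < ν) (h0A : IsAxisymmetric (X.u 0))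
    (hfA : ∀ t ∈ Ico 0 X.T, IsAxisymmetric (X.f t)) :
    ∃ C : ℝ, 0 ≤ C ∧ ∀ t ∈ Ico 0 X.T, ∀ x, |swirl (X.u t) x| ≤ C := by
  obtain ⟨M, hM0, hM⟩ := X.exists_abs_swirl_datum_le
  obtain ⟨F, hF0, hF⟩ := X.exists_abs_swirl_force_le
  refine ⟨M + F * X.T, by have := X.T_pos; positivity, fun t ht x => ?_⟩
  have h := X.abs_swirl_le hν h0A hfA hM (fun s hs y => hF s hs.1 y) t ht x
  have hFt : F * t ≤ F * X.T := mul_le_mul_of_nonneg_left ht.2.le hF0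
  linarith

/-- **The azimuthal velocity of an axisymmetric Clay blow-up obeys the `C/r` bound**: off the axis,
`|u_θ(t, x)| ≤ C / r` on `[0, T)` (`Γ = r u_θ`, `swirl_eq_cylRadius_mul_swirlVelocity`). The singular
points lie ON the axis (`singularSlice_subset_axis`, g7), where `Γ = 0`.
[cite: KochNadirashviliSereginSverak2009, §1 (1.9) and Thm. 6.1] -/
theorem abs_swirlVelocity_le (hν : 0 < ν) (h0A : IsAxisymmetric (X.u 0))
    (hfA : ∀ t ∈ Ico 0 X.T, IsAxisymmetric (X.f t)) :
    ∃ C : ℝ, 0 ≤ C ∧ ∀ t ∈ Ico 0 X.T, ∀ x : EuclideanSpace ℝ (Fin 3), cylRadius x ≠ 0 →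
      |swirlVelocity (X.u t) x| ≤ C / cylRadius x := by
  obtain ⟨C, hC0, hC⟩ := X.swirl_bounded hν h0A hfA
  refine ⟨C, hC0, fun t ht x hx => ?_⟩
  have hr : 0 < cylRadius x := lt_of_le_of_ne (cylRadius_nonneg x) (Ne.symm hx)
  rw [le_div_iff₀ hr, mul_comm]
  have h := hC t ht x
  rwa [swirl_eq_cylRadius_mul_swirlVelocity (X.u t) hx, abs_mul, abs_of_pos hr] at h

/-- **`r|u| ≤ r|ū| + C` for an axisymmetric Clay blow-up** (`ū = poloidalPart u = u − u_θ e_θ`): any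
`C/r`-type bound on the full velocity of an axisymmetric Clay blow-up is a statement about its
POLOIDAL field (`cylRadius_mul_norm_le_poloidal_add_abs_swirl` with `swirl_bounded`).
[cite: SereginSverak2009, §1 (1.2)] -/
theorem cylRadius_mul_norm_le_poloidal_add (hν : 0 < ν) (h0A : IsAxisymmetric (X.u 0))
    (hfA : ∀ t ∈ Ico 0 X.T, IsAxisymmetric (X.f t)) :
    ∃ C : ℝ, 0 ≤ C ∧ ∀ t ∈ Ico 0 X.T, ∀ x : EuclideanSpace ℝ (Fin 3),
      cylRadius x * ‖X.u t x‖ ≤ cylRadius x * ‖poloidalPart (X.u t) x‖ + C := by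
  obtain ⟨C, hC0, hC⟩ := X.swirl_bounded hν h0A hfA
  exact ⟨C, hC0, fun t ht x =>
    (cylRadius_mul_norm_le_poloidal_add_abs_swirl (X.u t) x).trans (by linarith [hC t ht x])⟩

/-! ## §3 The unforced type: the blow-up is carried by the poloidal field -/

/-- **AN UNFORCED AXISYMMETRIC CLAY BLOW-UP HAS UNBOUNDED WEIGHTED POLOIDAL VELOCITY `r |ū|`**
(`ν > 0`, zero force, axisymmetric datum; no named fact): there is no `C` with
`r ‖ū(t, x)‖ ≤ C` on `[0, T) × ℝ³` — Seregin–Šverák's hypothesis (1.2) on the meridional part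
`v̄ = v_ϱ e_ϱ + v₃ e₃` fails. The swirl is bounded (`swirl_bounded`, the force `0` being axisymmetric),
so a poloidal `C/r` bound would give the full `r|u| ≤ C + C_Γ`
(`cylRadius_mul_norm_le_of_poloidal_of_swirl`), the second Koch–Nadirashvili–Seregin–Šverák
alternative excluded by `not_typeI_of_isAxisymmetric` (g7: KNSS Thm. 6.1 on the Leray–Hopf completion).
[cite: SereginSverak2009, §1 (1.2) and Thm. 1.2] [cite: KochNadirashviliSereginSverak2009, Thm. 6.1] -/
theorem poloidal_axisDecay_unbounded (hν : 0 < ν) (hf : X.f = 0) (h0A : IsAxisymmetric (X.u 0)) :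
    ¬ ∃ C : ℝ, ∀ t ∈ Ico 0 X.T, ∀ x : EuclideanSpace ℝ (Fin 3),
      cylRadius x * ‖poloidalPart (X.u t) x‖ ≤ C := by
  have hfA : ∀ t ∈ Ico 0 X.T, IsAxisymmetric (X.f t) := fun t _ => by
    rw [hf]; exact isAxisymmetric_zero
  rintro ⟨C, hC⟩
  obtain ⟨CΓ, -, hΓ⟩ := X.swirl_bounded hν h0A hfA
  exact (X.not_typeI_of_isAxisymmetric hν hf h0A).2
    ⟨C + CΓ, fun t ht x => cylRadius_mul_norm_le_of_poloidal_of_swirl (hC t ht) (hΓ t ht) x⟩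

/-- **Kill form**: for every `C` there are `t ∈ [0, T)` and `x` with `C < r ‖ū(t, x)‖` — an unforced
axisymmetric Clay blow-up blows up through its POLOIDAL field near the axis, at a rate beating `C/r`
for every `C`, while its swirl `r u_θ` stays bounded. [cite: SereginSverak2009, §1 (1.2) and Thm. 1.2] -/
theorem exists_poloidal_axisDecay_gt (hν : 0 < ν) (hf : X.f = 0) (h0A : IsAxisymmetric (X.u 0))
    (C : ℝ) : ∃ t ∈ Ico 0 X.T, ∃ x : EuclideanSpace ℝ (Fin 3),
      C < cylRadius x * ‖poloidalPart (X.u t) x‖ := by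
  by_contra h
  push Not at h
  exact X.poloidal_axisDecay_unbounded hν hf h0A ⟨C, h⟩

/-- **PORTRAIT OF AN UNFORCED AXISYMMETRIC CLAY BLOW-UP, SWIRL VS POLOIDAL** (`ν > 0`, `f = 0`,
axisymmetric datum): (i) the swirl `r u_θ` is bounded on `[0, T) × ℝ³`; (ii) the weighted poloidal
velocity `r|ū|` is unbounded there; (iii) the blow-up is not Type I and escapes the full `C/r` bound
(g7); (iv) every singular point of the final slice lies on the axis (g7).
[cite: KochNadirashviliSereginSverak2009, §1 (1.9), Thms. 6.1–6.2] [cite: SereginSverak2009, §1 (1.2), §3] -/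
theorem axisymmetric_swirl_portrait_of_force_eq_zero (hν : 0 < ν) (hf : X.f = 0)
    (h0A : IsAxisymmetric (X.u 0)) :
    (∃ C : ℝ, 0 ≤ C ∧ ∀ t ∈ Ico 0 X.T, ∀ x, |swirl (X.u t) x| ≤ C) ∧
      (¬ ∃ C : ℝ, ∀ t ∈ Ico 0 X.T, ∀ x : EuclideanSpace ℝ (Fin 3),
        cylRadius x * ‖poloidalPart (X.u t) x‖ ≤ C) ∧
      ¬ IsTypeIBlowup X.u X.T ∧
      (¬ ∃ C : ℝ, ∀ t ∈ Ico 0 X.T, ∀ x : EuclideanSpace ℝ (Fin 3), cylRadius x * ‖X.u t x‖ ≤ C) ∧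
      {x₀ : EuclideanSpace ℝ (Fin 3) | ¬ IsBackwardBoundedAt X.u X.T x₀} ⊆
        {x : EuclideanSpace ℝ (Fin 3) | cylRadius x = 0} := by
  have hfA : ∀ t ∈ Ico 0 X.T, IsAxisymmetric (X.f t) := fun t _ => by
    rw [hf]; exact isAxisymmetric_zero
  have hK := X.not_typeI_of_isAxisymmetric hν hf h0A
  exact ⟨X.swirl_bounded hν h0A hfA, X.poloidal_axisDecay_unbounded hν hf h0A, hK.1, hK.2,
    X.singularSlice_subset_axis hν h0A hfA⟩

end ClayBlowup

/-! ## §4 The strong type -/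

namespace DesignedBlowup

variable {ν : ℝ} (D : DesignedBlowup ν)

/-- **The swirl of an axisymmetric designed blow-up grows at most linearly** (`ν > 0`):
`|r u_θ(t, x)| ≤ M + F t` on `[0, T)`. [cite: KochNadirashviliSereginSverak2009, §1 (1.8)–(1.9)] -/
theorem abs_swirl_le (hν : 0 < ν) (h0A : IsAxisymmetric (D.u 0))
    (hfA : ∀ t ∈ Ico 0 D.T, IsAxisymmetric (D.f t)) {M F : ℝ}
    (hM : ∀ x, |swirl (D.u 0) x| ≤ M) (hF : ∀ t ∈ Ico 0 D.T, ∀ x, |swirl (D.f t) x| ≤ F) :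
    ∀ t ∈ Ico 0 D.T, ∀ x, |swirl (D.u t) x| ≤ M + F * t :=
  D.toClayBlowup.abs_swirl_le hν h0A hfA hM hF

/-- **The azimuthal circulation of an axisymmetric designed blow-up is bounded up to `T`** (`ν > 0`).
[cite: KochNadirashviliSereginSverak2009, §1 (1.8)–(1.9)] -/
theorem swirl_bounded (hν : 0 < ν) (h0A : IsAxisymmetric (D.u 0))
    (hfA : ∀ t ∈ Ico 0 D.T, IsAxisymmetric (D.f t)) :
    ∃ C : ℝ, 0 ≤ C ∧ ∀ t ∈ Ico 0 D.T, ∀ x, |swirl (D.u t) x| ≤ C :=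
  D.toClayBlowup.swirl_bounded hν h0A hfA

/-- **`|u_θ| ≤ C/r` for an axisymmetric designed blow-up** (`ν > 0`).
[cite: KochNadirashviliSereginSverak2009, §1 (1.9) and Thm. 6.1] -/
theorem abs_swirlVelocity_le (hν : 0 < ν) (h0A : IsAxisymmetric (D.u 0))
    (hfA : ∀ t ∈ Ico 0 D.T, IsAxisymmetric (D.f t)) :
    ∃ C : ℝ, 0 ≤ C ∧ ∀ t ∈ Ico 0 D.T, ∀ x : EuclideanSpace ℝ (Fin 3), cylRadius x ≠ 0 →
      |swirlVelocity (D.u t) x| ≤ C / cylRadius x :=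
  D.toClayBlowup.abs_swirlVelocity_le hν h0A hfA

/-- **An unforced axisymmetric designed blow-up has unbounded `r|ū|`** (`ν > 0`).
[cite: SereginSverak2009, §1 (1.2) and Thm. 1.2] -/
theorem poloidal_axisDecay_unbounded (hν : 0 < ν) (hf : D.f = 0) (h0A : IsAxisymmetric (D.u 0)) :
    ¬ ∃ C : ℝ, ∀ t ∈ Ico 0 D.T, ∀ x : EuclideanSpace ℝ (Fin 3),
      cylRadius x * ‖poloidalPart (D.u t) x‖ ≤ C :=
  D.toClayBlowup.poloidal_axisDecay_unbounded hν hf h0A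

end DesignedBlowup

/-! ## §5 The (C)- and (A)-readings -/

/-- **IF (C) IS CERTIFIED BY AN AXISYMMETRIC DESIGN, THE CERTIFICATE'S SWIRL STAYS BOUNDED WHILE IT
BLOWS UP ON THE AXIS**: for every `ν > 0` and every Clay blow-up with axisymmetric datum and force,
the azimuthal circulation `r u_θ` is bounded on `[0, T) × ℝ³`, some point of the axis inside the ball
`B̄(0, R)` of `exists_singularPoint_on_axis` is singular at `T`, and the velocity is unbounded inside
every tube around the axis (g7). Nothing here says such a blow-up exists.
[cite: FeffermanClay2006, (C)] [cite: KochNadirashviliSereginSverak2009, §1 (1.9)] -/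
theorem axisymmetric_clayBlowup_swirl_bounded {ν : ℝ} (hν : 0 < ν) (X : ClayBlowup ν)
    (h0A : IsAxisymmetric (X.u 0)) (hfA : ∀ t ∈ Ico 0 X.T, IsAxisymmetric (X.f t)) :
    (∃ C : ℝ, 0 ≤ C ∧ ∀ t ∈ Ico 0 X.T, ∀ x, |swirl (X.u t) x| ≤ C) ∧
      (∃ x₀ : EuclideanSpace ℝ (Fin 3), cylRadius x₀ = 0 ∧ ¬ IsBackwardBoundedAt X.u X.T x₀) ∧
      ∀ ρ₀ : ℝ, 0 < ρ₀ → ∀ M t₀ : ℝ, t₀ < X.T →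
        ∃ t ∈ Ioo t₀ X.T, ∃ x : EuclideanSpace ℝ (Fin 3), cylRadius x < ρ₀ ∧ M < ‖X.u t x‖ := by
  obtain ⟨⟨-, -, x₀, -, hx₀, hs⟩, -, -⟩ := X.exists_singularPoint_on_axis hν h0A hfA
  exact ⟨X.swirl_bounded hν h0A hfA, ⟨x₀, hx₀, hs⟩,
    fun ρ₀ hρ₀ M t₀ ht₀ => X.unbounded_in_axis_tube hν h0A hfA hρ₀ M ht₀⟩

/-- **IF CLAY (A) FAILS FOR AN AXISYMMETRIC DATUM, IT FAILS THROUGH THE POLOIDAL FIELD**: every unforced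
Clay blow-up with axisymmetric datum (the type whose inhabitants are exactly the axisymmetric
counterexamples to (A), `exists_unforced_clayBlowup_of_not_navierStokesRegularity`) keeps its swirl
`r u_θ` bounded and has `sup r|ū| = ∞` on `[0, T) × ℝ³`. [cite: FeffermanClay2006, (A)]
[cite: SereginSverak2009, §1 (1.2) and Thm. 1.2] -/
theorem unforced_axisymmetric_clayBlowup_blows_up_poloidally {ν : ℝ} (hν : 0 < ν) (X : ClayBlowup ν)
    (hf : X.f = 0) (h0A : IsAxisymmetric (X.u 0)) :
    (∃ C : ℝ, 0 ≤ C ∧ ∀ t ∈ Ico 0 X.T, ∀ x, |swirl (X.u t) x| ≤ C) ∧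
      ∀ C : ℝ, ∃ t ∈ Ico 0 X.T, ∃ x : EuclideanSpace ℝ (Fin 3),
        C < cylRadius x * ‖poloidalPart (X.u t) x‖ :=
  ⟨(X.axisymmetric_swirl_portrait_of_force_eq_zero hν hf h0A).1,
    X.exists_poloidal_axisDecay_gt hν hf h0A⟩

end Summit.NavierStokesRegularity.FluidComputer

end
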